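import Summits.QuantumFields.GaugeBoot.TorusPartitionUpperBound
import Summits.QuantumFields.GaugeBoot.TorusAxialGaugeLowerBound
import Summits.QuantumFields.GaugeBoot.FreeEnergyPlaquetteBounds
import HarnessLib

/-!
# Gauge-boot: THE PLAQUETTE DEFICIT IS `O(1/β)` UNIFORMLY IN THE VOLUME — the free-energy sandwich
# (peeling upper bound × axial-gauge lower bound) from `dim G`-dimensional one-link bounds
# (supplement 21, part 3e)

HONEST FRAMING (cell `pub-gaugeboot`, page 1 of every file): certified bounds on lattice
expectations at STATED coupling, gauge group, dimension and torus size; NOT a mass gap, NOT a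
continuum limit, NOT a string tension, NOT large `N`; NOT Yang–Mills-summit-bearing (barriers
`FixedCouplingUltralocality`, `PerturbativeInvisibility`).  An analytic weak-coupling bound with
explicit constants; at the cell's table couplings it is weaker than the certificates.  It certifies no
number of the tables.

## Content

For a compact second-countable `G`, a continuous `ρ` and one-link data of "dimension `2k`":
`(hz)` `log ∫_G e^{−β'(N − Re tr ρ)} dHaar ≤ a − k log β'` for all `β' > 0` (Laplace upper bound) and
`(hq)` `log Haar{N − Re tr ρ ≤ η} ≥ b + k log η` for `0 < η ≤ η₀` (small-ball lower bound) — both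
available with `k = dim G/2` for `U(N)` and `SU(N)` (parts 3a, 3b, 3f) — the supporting line of the
convex `log Z_L` at `(β, β/2)`, the peeling bound `log Z_L(β/2) ≤ #assigned · log z(β/2)` (part 3c) and
the axial-gauge bound `log Z_L(β) ≥ −16·#P + #nonForest · log Haar{… ≤ 1/β}` (part 3d) give, with
`#nonForest − #assigned = d·L^{d−1}` (the ONLY mismatch: one boundary slice and one Polyakov line
per direction-`0` circle):

* ★★★ `DeficitRate.wilsonExpectation_wilsonAction_le` —
  `(β/2)⟨S⟩_{β,L} ≤ d L^{d−1} k log β + #assigned·|a + k log 2| + #nonForest·|b| + 16·#P`;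
* ★★★ `DeficitRate.one_sub_meanPlaquette_le` — for `d ≥ 2`, `N ≥ 1`, every `L ≥ 1` and every
  `β ≥ max(2, 1/η₀)`:
  **`1 − ⟨ū_P⟩_{β,L} ≤ (2/(Nβ)) · (16 + (2/d)|a + k log 2| + (2/(d−1))|b| + (2k/((d−1)L)) log β)`** —
  `O(1/β)` up to a `log β/(Lβ)` finite-size term;
* ★★★ `DeficitRate.one_sub_integral_plaquette_le_of_mem_limitPoints` — at every infinite-volume limit point
  `μ` at such `β` and every plaquette: **`1 − ∫ (1/N) Re tr U_P dμ ≤ (2/(Nβ))(16 + (2/d)|a + k log 2| + (2/(d−1))|b|)`**.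

With the equipartition LOWER bound of supplement 18 (`1 − ⟨ū_P⟩ ≥ c_N/(4(d−1)β + c_N)`) the plaquette
deficit of every infinite-volume limit state is pinned to `Θ(1/β)` at weak coupling, with explicit
constants, for every compact gauge group with `2k`-dimensional one-link bounds — WHAT REMAINS (lxxvi) of
the lane's binder.  [folklore] (free-energy sandwich: e.g. S. Chatterjee, arXiv:1602.01222 §§7–10 for
`U(N)` on cubes; Griffiths' convexity lemma.)
-/

noncomputable section

open MeasureTheory Filter Topology
open Literature.MathematicalPhysics.QuantumFieldTheory
open Literature.MathematicalPhysics.QuantumLattice (LGConfig plaquetteObs infiniteVolumeLimitPoints torusLogPartition)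
open Literature.RepresentationTheory.CompactGroups

namespace Summit.QuantumFields.GaugeBoot

namespace DeficitRate

variable {d L N : ℕ} [NeZero d] [NeZero L] {G : Type*} [Group G] [TopologicalSpace G] [IsTopologicalGroup G]
  [CompactSpace G] [MeasurableSpace G] [BorelSpace G] [SecondCountableTopology G]
  (ρ : G →* Matrix (Fin N) (Fin N) ℂ)

/-! ### Counting in `ℝ` -/

omit [NeZero d] in
/-- `|Λ_L| = L^d` in `ℝ`. -/
theorem card_site_real : (Fintype.card (Site d L) : ℝ) = (L : ℝ) ^ d := by
  rw [Fintype.card_fun, ZMod.card, Fintype.card_fin]; push_cast; ring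

omit [NeZero d] in
/-- `#P = L^d · d(d−1)/2` in `ℝ`. -/
theorem card_plaquette_real : (Fintype.card (Plaquette d L) : ℝ) = (L : ℝ) ^ d * ((d : ℝ) * ((d : ℝ) - 1) / 2) := by
  rw [SU2Rate.card_plaquette_eq, Nat.cast_mul, card_site_real]
  congr 1
  have h := SU2Rate.two_mul_card_ltPair d
  rcases Nat.eq_zero_or_pos d with hd | hd
  · subst hd; simp
  · have hcast : (2 : ℝ) * Fintype.card {p : Fin d × Fin d // p.1 < p.2} = (d : ℝ) * ((d : ℝ) - 1) := by
      have := congrArg (fun n : ℕ => (n : ℝ)) h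
      push_cast [Nat.cast_sub hd] at this
      linarith
    linarith

/-- `#assigned = (d−1)(L−1)L^{d−1}` in `ℝ`. -/
theorem card_assigned_real :
    ((Peel.assigned d L).card : ℝ) = ((d : ℝ) - 1) * ((L : ℝ) - 1) * (L : ℝ) ^ (d - 1) := by
  have h := Peel.card_assigned (d := d) (L := L)
  have hL : (L : ℝ) ≠ 0 := by exact_mod_cast NeZero.ne L
  have hd : 1 ≤ d := Nat.one_le_iff_ne_zero.2 (NeZero.ne d)
  have hL1 : 1 ≤ L := Nat.one_le_iff_ne_zero.2 (NeZero.ne L)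
  have hcast := congrArg (fun n : ℕ => (n : ℝ)) h
  push_cast [Nat.cast_sub hd, Nat.cast_sub hL1] at hcast
  have hpow : (L : ℝ) ^ d = L * (L : ℝ) ^ (d - 1) := by
    rw [← pow_succ']; congr 1; omega
  rw [hpow] at hcast
  apply mul_left_cancel₀ hL
  linear_combination hcast

/-- `#nonForest = (d−1)L^d + L^{d−1}` in `ℝ`. -/
theorem card_nonTree_real :
    ((AxialGauge.nonTree d L).card : ℝ) = ((d : ℝ) - 1) * (L : ℝ) ^ d + (L : ℝ) ^ (d - 1) := by
  have h := AxialGauge.card_nonTree (d := d) (L := L)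
  have hL : (L : ℝ) ≠ 0 := by exact_mod_cast NeZero.ne L
  have hd : 1 ≤ d := Nat.one_le_iff_ne_zero.2 (NeZero.ne d)
  have hcast := congrArg (fun n : ℕ => (n : ℝ)) h
  push_cast [Nat.cast_sub hd] at hcast
  have hpow : (L : ℝ) ^ d = L * (L : ℝ) ^ (d - 1) := by
    rw [← pow_succ']; congr 1; omega
  have hpow' : (L : ℝ) ^ (d + 1) = L * (L : ℝ) ^ d := by rw [pow_succ']
  rw [hpow', hpow] at hcast
  apply mul_left_cancel₀ hL
  rw [hpow]
  linear_combination hcast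

/-! ### The free-energy sandwich -/

/-- ★★★ **The mean action from one-link data.**  If `log z(β') ≤ a − k log β'` for all `β' > 0`
(`z(β') = ∫_G e^{−β'(N − Re tr ρ)}`) and `log Haar{N − Re tr ρ ≤ η} ≥ b + k log η` for `0 < η ≤ η₀`, then
for `β ≥ max(2, 1/η₀)`:
`(β/2)⟨S⟩_{β,L} ≤ (#nonForest − #assigned)·k·log β + #assigned·|a + k log 2| + #nonForest·|b| + 16·#P`.
[folklore] -/
theorem wilsonExpectation_wilsonAction_le (hρ : Continuous ρ) {k a b η₀ : ℝ} (hη₀ : 0 < η₀)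
    (hz : ∀ β' : ℝ, 0 < β' → Real.log (∫ g, Peel.weight ρ β' g ∂(haarProbability G)) ≤ a - k * Real.log β')
    (hq : ∀ η : ℝ, 0 < η → η ≤ η₀ →
      0 < (haarProbability G).real {g : G | (N : ℝ) - ((ρ g).trace).re ≤ η} ∧
      b + k * Real.log η ≤ Real.log ((haarProbability G).real {g : G | (N : ℝ) - ((ρ g).trace).re ≤ η}))
    {β : ℝ} (hβ2 : 2 ≤ β) (hβη : 1 / η₀ ≤ β) :
    β / 2 * wilsonExpectation ρ β (wilsonAction (d := d) (L := L) (G := G) ρ) ≤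
      (((AxialGauge.nonTree d L).card : ℝ) - (Peel.assigned d L).card) * k * Real.log β +
        (Peel.assigned d L).card * |a + k * Real.log 2| + (AxialGauge.nonTree d L).card * |b| +
        16 * (Fintype.card (Plaquette d L) : ℝ) := by
  have hβ0 : 0 < β := by linarith
  set m : ℝ := ((Peel.assigned d L).card : ℝ) with hm
  set n : ℝ := ((AxialGauge.nonTree d L).card : ℝ) with hn
  set P : ℝ := (Fintype.card (Plaquette d L) : ℝ) with hP
  have hm0 : 0 ≤ m := Nat.cast_nonneg _
  have hn0 : 0 ≤ n := Nat.cast_nonneg _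
  -- supporting line at `(β, β/2)`
  have hsupp := mul_wilsonExpectation_wilsonAction_le (d := d) (L := L) ρ hρ β (β / 2)
  -- upper bound at `β/2` (peeling)
  have hup : torusLogPartition d ρ (β / 2) L ≤ m * (a + k * Real.log 2) - m * k * Real.log β := by
    have h1 := Peel.torusLogPartition_le (d := d) (L := L) ρ hρ (β := β / 2) (by linarith)
    have h2 := hz (β / 2) (by linarith)
    rw [Real.log_div hβ0.ne' two_ne_zero] at h2
    have h3 : m * Real.log (∫ g, Peel.weight ρ (β / 2) g ∂(haarProbability G)) ≤
        m * (a - k * (Real.log β - Real.log 2)) := mul_le_mul_of_nonneg_left h2 hm0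
    linarith
  -- lower bound at `β` (axial gauge, `η = 1/β`)
  have hlow : -(16 * P) + n * b - n * k * Real.log β ≤ torusLogPartition d ρ β L := by
    have hη : 0 < 1 / β := by positivity
    have hη' : 1 / β ≤ η₀ := by
      rw [div_le_iff₀ hβ0]; rw [div_le_iff₀ hη₀] at hβη; linarith
    obtain ⟨hpos, hqb⟩ := hq (1 / β) hη hη'
    have h1 := AxialGauge.torusLogPartition_ge (d := d) (L := L) ρ hρ hβ0.le hη.le hpos
    rw [one_div, Real.log_inv] at hqb
    have h3 : n * (b + k * -Real.log β) ≤
        n * Real.log ((haarProbability G).real {g : G | (N : ℝ) - ((ρ g).trace).re ≤ β⁻¹}) :=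
      mul_le_mul_of_nonneg_left hqb hn0
    have h4 : β * (16 * (1 / β) * P) = 16 * P := by field_simp
    rw [h4] at h1
    rw [one_div] at h1
    linarith
  have habs₁ : m * (a + k * Real.log 2) ≤ m * |a + k * Real.log 2| := mul_le_mul_of_nonneg_left (le_abs_self _) hm0
  have habs₂ : -(n * b) ≤ n * |b| := by nlinarith [neg_abs_le b]
  have : (β - β / 2) = β / 2 := by ring
  rw [this] at hsupp
  linarith

/-- ★★★ **`O(1/β)` up to a finite-size `log β/L`: the mean plaquette on every torus.**  Under the one-link
hypotheses, for `d ≥ 2`, `N ≥ 1`, every `L` and every `β ≥ max(2, 1/η₀)`: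
`1 − ⟨ū_P⟩_{β,L} ≤ (2/(Nβ)) · (16 + (2/d)|a + k log 2| + (2/(d−1))|b| + (2k/((d−1)L)) log β)`. [folklore] -/
theorem one_sub_meanPlaquette_le (hρ : Continuous ρ) (hN : N ≠ 0) (hd : 2 ≤ d) {k a b η₀ : ℝ}
    (hη₀ : 0 < η₀)
    (hz : ∀ β' : ℝ, 0 < β' → Real.log (∫ g, Peel.weight ρ β' g ∂(haarProbability G)) ≤ a - k * Real.log β')
    (hq : ∀ η : ℝ, 0 < η → η ≤ η₀ →
      0 < (haarProbability G).real {g : G | (N : ℝ) - ((ρ g).trace).re ≤ η} ∧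
      b + k * Real.log η ≤ Real.log ((haarProbability G).real {g : G | (N : ℝ) - ((ρ g).trace).re ≤ η}))
    {β : ℝ} (hβ2 : 2 ≤ β) (hβη : 1 / η₀ ≤ β) :
    1 - wilsonExpectation ρ β (meanPlaquette (d := d) (L := L) (G := G) ρ) ≤
      2 / (N * β) * (16 + 2 / d * |a + k * Real.log 2| + 2 / ((d : ℝ) - 1) * |b| +
        2 * k / (((d : ℝ) - 1) * L) * Real.log β) := by
  haveI : Nonempty (Plaquette d L) := nonempty_plaquette_of_two_le hd
  have hβ0 : 0 < β := by linarith
  have hNpos : (0 : ℝ) < N := by exact_mod_cast Nat.pos_of_ne_zero hN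
  have hLpos : (0 : ℝ) < L := by exact_mod_cast Nat.pos_of_ne_zero (NeZero.ne L)
  have hd2 : (2 : ℝ) ≤ d := by exact_mod_cast hd
  have hd1 : (0 : ℝ) < (d : ℝ) - 1 := by linarith
  have hP : (0 : ℝ) < Fintype.card (Plaquette d L) := by exact_mod_cast Fintype.card_pos
  have hS := wilsonExpectation_wilsonAction_le (d := d) (L := L) ρ hρ hη₀ hz hq hβ2 hβη
  rw [wilsonExpectation_meanPlaquette_eq ρ hρ hN β, sub_sub_cancel]
  -- counts
  have hm := card_assigned_real (d := d) (L := L)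
  have hn := card_nonTree_real (d := d) (L := L)
  have hPe := card_plaquette_real (d := d) (L := L)
  have hpow : (L : ℝ) ^ d = L * (L : ℝ) ^ (d - 1) := by
    rw [← pow_succ']; congr 1; omega
  have hLd1 : (0 : ℝ) < (L : ℝ) ^ (d - 1) := by positivity
  have hlog : 0 ≤ Real.log β := Real.log_nonneg (by linarith)
  set m : ℝ := ((Peel.assigned d L).card : ℝ)
  set n : ℝ := ((AxialGauge.nonTree d L).card : ℝ)
  set P : ℝ := (Fintype.card (Plaquette d L) : ℝ)
  set W := wilsonExpectation ρ β (wilsonAction (d := d) (L := L) (G := G) ρ)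
  -- `W ≤ (2/β) · RHS`
  have hW : W ≤ 2 / β * ((n - m) * k * Real.log β + m * |a + k * Real.log 2| + n * |b| + 16 * P) := by
    rw [div_mul_eq_mul_div, le_div_iff₀ hβ0]; linarith
  rw [div_le_iff₀ (by positivity)]
  -- compare term by term after multiplying out
  have hnm : n - m = (d : ℝ) * (L : ℝ) ^ (d - 1) := by rw [hn, hm, hpow]; ring
  have hmP : m * |a + k * Real.log 2| ≤ 2 / d * |a + k * Real.log 2| * P := by
    have : m ≤ 2 / d * P := by
      rw [hm, hPe, hpow]
      rw [show 2 / (d : ℝ) * (L * (L : ℝ) ^ (d - 1) * ((d : ℝ) * ((d : ℝ) - 1) / 2)) =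
        ((d : ℝ) - 1) * L * (L : ℝ) ^ (d - 1) by field_simp]
      have : ((L : ℝ) - 1) ≤ L := by linarith
      nlinarith
    calc m * |a + k * Real.log 2| ≤ (2 / d * P) * |a + k * Real.log 2| :=
          mul_le_mul_of_nonneg_right this (abs_nonneg _)
      _ = _ := by ring
  have hnP : n * |b| ≤ 2 / ((d : ℝ) - 1) * |b| * P := by
    have : n ≤ 2 / ((d : ℝ) - 1) * P := by
      rw [hn, hPe, hpow, div_mul_eq_mul_div, le_div_iff₀ hd1]
      have hL1 : (1 : ℝ) ≤ L := by exact_mod_cast Nat.one_le_iff_ne_zero.2 (NeZero.ne L)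
      nlinarith [mul_le_mul_of_nonneg_left hL1 hLd1.le, hd1]
    calc n * |b| ≤ (2 / ((d : ℝ) - 1) * P) * |b| := mul_le_mul_of_nonneg_right this (abs_nonneg _)
      _ = _ := by ring
  have hkP : (n - m) * k * Real.log β = 2 * k / (((d : ℝ) - 1) * L) * Real.log β * P := by
    rw [hnm, hPe, hpow]; field_simp
  calc W ≤ 2 / β * ((n - m) * k * Real.log β + m * |a + k * Real.log 2| + n * |b| + 16 * P) := hW
    _ ≤ 2 / β * (2 * k / (((d : ℝ) - 1) * L) * Real.log β * P + 2 / d * |a + k * Real.log 2| * P +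
          2 / ((d : ℝ) - 1) * |b| * P + 16 * P) :=
        mul_le_mul_of_nonneg_left (by linarith [hkP, hmP, hnP]) (by positivity)
    _ = 2 / (N * β) * (16 + 2 / d * |a + k * Real.log 2| + 2 / ((d : ℝ) - 1) * |b| +
          2 * k / (((d : ℝ) - 1) * L) * Real.log β) * (N * (Fintype.card (Plaquette d L) : ℝ)) := by
        simp only [P]; field_simp; ring

/-! ### Infinite-volume limit points -/

/-- ★★★ **`O(1/β)` at every infinite-volume limit point.**  Under the one-link hypotheses, for `d ≥ 2`,
`N ≥ 1`, every `β ≥ max(2, 1/η₀)`, every infinite-volume limit point `μ` of the torus Wilson states at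
`β` and every plaquette `(x; i ≠ j)` of `ℤ^d`:
`1 − ∫ (1/N) Re tr U_P dμ ≤ (2/(Nβ)) · (16 + (2/d)|a + k log 2| + (2/(d−1))|b|)`. [folklore] -/
theorem one_sub_integral_plaquette_le_of_mem_limitPoints (hρ : Continuous ρ) (hN : N ≠ 0) (hd : 2 ≤ d)
    {k a b η₀ : ℝ} (hη₀ : 0 < η₀)
    (hz : ∀ β' : ℝ, 0 < β' → Real.log (∫ g, Peel.weight ρ β' g ∂(haarProbability G)) ≤ a - k * Real.log β')
    (hq : ∀ η : ℝ, 0 < η → η ≤ η₀ →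
      0 < (haarProbability G).real {g : G | (N : ℝ) - ((ρ g).trace).re ≤ η} ∧
      b + k * Real.log η ≤ Real.log ((haarProbability G).real {g : G | (N : ℝ) - ((ρ g).trace).re ≤ η}))
    {β : ℝ} (hβ2 : 2 ≤ β) (hβη : 1 / η₀ ≤ β)
    {μ : Measure (LGConfig d G)} (hμ : μ ∈ infiniteVolumeLimitPoints (d := d) ρ β)
    (x : Literature.Probability.LatticeModels.Site d) {i j : Fin d} (hij : i ≠ j) :
    1 - ∫ U, (N : ℝ)⁻¹ * plaquetteObs ρ x i j U ∂μ ≤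
      2 / (N * β) * (16 + 2 / d * |a + k * Real.log 2| + 2 / ((d : ℝ) - 1) * |b|) := by
  obtain ⟨Lk, hmono, hlim⟩ := hμ
  have ht := tendsto_wilsonExpectation_plaquetteTrace (d := d) ρ hρ hlim x i j
  -- the per-torus bounds along the subsequence
  set C : ℝ := 2 / (N * β) * (16 + 2 / d * |a + k * Real.log 2| + 2 / ((d : ℝ) - 1) * |b|) with hC
  set E : ℕ → ℝ := fun n => 2 / (N * β) * (2 * k / (((d : ℝ) - 1) * ((Lk n + 1 : ℕ) : ℝ)) * Real.log β) with hE
  have hbound : ∀ n : ℕ, 1 - wilsonExpectation ρ β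
      (plaquetteTrace ρ (Literature.Probability.LatticeModels.Torus.proj (Lk n + 1) x) i j) ≤ C + E n := by
    intro n
    haveI : NeZero (Lk n + 1) := ⟨Nat.succ_ne_zero _⟩
    rw [← wilsonExpectation_meanPlaquette_eq_plaquetteTrace ρ hρ β _ hij]
    have h := one_sub_meanPlaquette_le (d := d) (L := Lk n + 1) ρ hρ hN hd hη₀ hz hq hβ2 hβη
    rw [hC, hE]
    linarith
  -- the finite-size term tends to `0`
  have hE0 : Tendsto E atTop (𝓝 0) := by
    have h1 : Tendsto (fun n : ℕ => ((Lk n + 1 : ℕ) : ℝ)) atTop atTop := by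
      refine tendsto_natCast_atTop_atTop.comp ?_
      exact (tendsto_add_atTop_nat 1).comp hmono.tendsto_atTop
    have h2 : Tendsto (fun n : ℕ => (((d : ℝ) - 1) * ((Lk n + 1 : ℕ) : ℝ))⁻¹) atTop (𝓝 0) := by
      refine tendsto_inv_atTop_zero.comp ?_
      have h2d : (2 : ℝ) ≤ d := by exact_mod_cast hd
      exact Tendsto.const_mul_atTop (by linarith) h1
    have h3 : Tendsto (fun n : ℕ => 2 / (N * β) * (2 * k * (((d : ℝ) - 1) * ((Lk n + 1 : ℕ) : ℝ))⁻¹ * Real.log β))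
        atTop (𝓝 (2 / (N * β) * (2 * k * 0 * Real.log β))) :=
      ((h2.const_mul _).mul_const _).const_mul _
    rw [mul_zero, zero_mul, mul_zero] at h3
    refine h3.congr fun n => ?_
    simp only [hE, div_eq_mul_inv]
  have hlimB : Tendsto (fun n => C + E n) atTop (𝓝 C) := by
    simpa using (tendsto_const_nhds (x := C)).add hE0
  have hge : Tendsto (fun n => 1 - wilsonExpectation ρ β
      (plaquetteTrace ρ (Literature.Probability.LatticeModels.Torus.proj (Lk n + 1) x) i j)) atTop
      (𝓝 (1 - ∫ U, (N : ℝ)⁻¹ * plaquetteObs ρ x i j U ∂μ)) := tendsto_const_nhds.sub ht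
  exact le_of_tendsto_of_tendsto hge hlimB (Eventually.of_forall hbound)

end DeficitRate

end Summit.QuantumFields.GaugeBoot

end
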